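import Literature.AlgebraicGeometry.AbelianSchemes.AbelianSchemeDualIsogeny
import Literature.AlgebraicGeometry.AbelianSchemes.AbelianSchemeDualPairBaseChange
import HarnessLib

/-!
# The dual homomorphism commutes with base change: `(ψ_{S′})^∨ = (ψ^∨)_{S′}`
# (Mumford–Fogarty–Kirwan Ch. 6 §1 Cor. 6.8; Mumford AV §15 Thm. 1)
Topic `Literature/AlgebraicGeometry/AbelianSchemes`, namespace `Literature.AlgebraicGeometry.AbelianSchemes.AbelianSchemeOver.DualPair`.
THEOREMS ONLY (no definition, no named fact, no instance, no notation; net Literature debt 0).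
Cell `hodgecm-mathlib` (D-0151), FLOOR-0 P6 «MOD», letter ST-0′ «DUAL-POSITION KERNEL», row (H2) «base change».
## Mathematics
Let `g : S′ → S`, `ψ : A′ → B` a homomorphism of abelian `S`-schemes with dual pairs `D′ = (Â′, 𝒫′)`, `DB = (B̂, 𝒫_B)`,
and `D′_{S′}`, `DB_{S′}` the base-changed dual pairs (★ `DualPair.baseChange`: `(Â ×_S S′, 𝒫` pulled back`)`).  Then the
dual homomorphism of the base change `ψ_{S′} : A′_{S′} → B_{S′}` (★ `baseChangeHom`), formed with respect to the
base-changed pairs, is the base change of `ψ^∨`: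
  **`(ψ_{S′})^∨ ≫ pr_{Â′} = pr_{B̂} ≫ ψ^∨`**  (`dualIsogeny_baseChange_comp_fst`),
equivalently `(ψ_{S′})^∨ = ψ^∨ ×_S S′` as a morphism `B̂ ×_S S′ → Â′ ×_S S′` (`dualIsogeny_baseChange_eq_lift`).
Proof: both sides classify the same rigidified family on `A′_{B̂ ×_S S′}`, namely `(ψ × 1)^*𝒫_B` restricted along
`pr_{B̂} : B̂ ×_S S′ → B̂` — the left side by ★ `classify_baseChange_comp_fst`, the right side by the defining isomorphism
of `ψ^∨` (★ `nonempty_pullbackP_dualIsogeny_iso`) pulled back along `pr_{B̂}`; uniqueness of classifying maps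
(★ `eq_classify`) concludes.
## References
* [MumfordFogartyKirwan1994] D. Mumford, J. Fogarty, F. Kirwan, *Geometric Invariant Theory*, Ch. 6 §1 Cor. 6.8 (p. 118).
* [MumfordAV1970] D. Mumford, *Abelian Varieties*, §15 Thm. 1 (p. 143).
* [MilneAV2008] J. S. Milne, *Abelian Varieties*, I §8 (pp. 36–37).
-/

universe u

open CategoryTheory CategoryTheory.Limits AlgebraicGeometry MonoidalCategory CartesianMonoidalCategory

noncomputable section

namespace Literature.AlgebraicGeometry.AbelianSchemes

open scoped MonObj

namespace AbelianSchemeOver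

namespace DualPair

variable {S S' : Scheme.{u}} (g : S' ⟶ S) {A' B : AbelianSchemeOver S} (ψ : A'.X ⟶ B.X) [IsMonHom ψ]
  (D' : A'.DualPair) (DB : B.DualPair)

/-- `pr_{B̂} : B̂ ×_S S′ → B̂` followed by `ψ^∨` lies over `(B̂ ×_S S′ → S′) ≫ g`. [cite: MilneAV2008, I §8 pp. 36–37] -/
theorem fst_comp_dualIsogeny_comp_hom :
    (pullback.fst DB.hat.X.hom g ≫ dualIsogeny ψ D' DB) ≫ D'.hat.X.hom = (DB.hatBaseChange g).X.hom ≫ g := by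
  rw [Category.assoc, dualIsogeny_comp_hom, pullback.condition]
  rfl

/-- **The key isomorphism**: `(1 × (pr_{B̂} ≫ ψ^∨))^*𝒫′` on `A′_{B̂ ×_S S′}` (over `S` via `(B̂ ×_S S′ → S′) ≫ g`) is the
module of the family `(ψ_{S′} × 1)^*𝒫_{B,S′}` transported along `A′_{(B̂×S′ → S′) ≫ g} ≅ (A′_{S′})_{B̂ × S′}` — both are
`𝒫_B` pulled back along the same morphism `A′ ×_S (B̂ ×_S S′) → B ×_S B̂`. [cite: MilneAV2008, I §8 pp. 36–37]
[cite: MumfordFogartyKirwan1994, Ch. 6 §1 Cor. 6.8 (p. 118)] -/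
theorem nonempty_pullbackP_fst_comp_dualIsogeny_iso :
    Nonempty (D'.pullbackP ((DB.hatBaseChange g).X.hom ≫ g) (pullback.fst DB.hat.X.hom g ≫ dualIsogeny ψ D' DB)
        (fst_comp_dualIsogeny_comp_hom g ψ D' DB) ≅
      (@pullbackSelfBundle S' (A'.baseChange g) (B.baseChange g) (baseChangeHom ψ g) (isMonHom_baseChangeHom ψ g)
          (DB.baseChange g)).alongBaseChange.L) := by
  haveI := isMonHom_baseChangeHom ψ g
  set f' : pullback DB.hat.X.hom g ⟶ S' := (DB.hatBaseChange g).X.hom with hf'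
  set u : pullback DB.hat.X.hom g ⟶ DB.hat.X.left := pullback.fst DB.hat.X.hom g with hu
  have hug : u ≫ DB.hat.X.hom = f' ≫ g := pullback.condition
  have hr : pullback.fst A'.X.hom (f' ≫ g) ≫ A'.X.hom = (pullback.snd A'.X.hom (f' ≫ g) ≫ u) ≫ DB.hat.X.hom := by
    rw [pullback.condition, Category.assoc, hug]
  -- the restriction map `r = (pr_{A′}, pr ≫ u) : A′_{(B̂×S′→S′)≫g} → A′_{B̂}` over `u = pr_{B̂}`
  set r : (A'.baseChange (f' ≫ g)).X.left ⟶ (A'.baseChange DB.hat.X.hom).X.left :=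
    pullback.lift (pullback.fst A'.X.hom (f' ≫ g)) (pullback.snd A'.X.hom (f' ≫ g) ≫ u) hr with hrdef
  have hr₁ : r ≫ pullback.fst A'.X.hom DB.hat.X.hom = pullback.fst A'.X.hom (f' ≫ g) := pullback.lift_fst _ _ _
  have hr₂ : r ≫ pullback.snd A'.X.hom DB.hat.X.hom = pullback.snd A'.X.hom (f' ≫ g) ≫ u := pullback.lift_snd _ _ _
  -- (1) `r ≫ (1 × ψ^∨) = 1 × (u ≫ ψ^∨)` as maps to `A′ ×_S Â′`
  have h1 : r ≫ A'.baseChangeToProd D'.hat DB.hat.X.hom (dualIsogeny ψ D' DB) (dualIsogeny_comp_hom ψ D' DB) =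
      A'.baseChangeToProd D'.hat (f' ≫ g) (u ≫ dualIsogeny ψ D' DB) (fst_comp_dualIsogeny_comp_hom g ψ D' DB) := by
    apply pullback.hom_ext
    · rw [Category.assoc]
      erw [pullback.lift_fst, pullback.lift_fst, pullback.lift_fst]
    · rw [Category.assoc]
      erw [pullback.lift_snd, pullback.lift_snd, pullback.lift_snd_assoc]
      exact Category.assoc _ _ _
  -- (2) `e ≫ (ψ_{S′} × 1) ≫ (B_{S′} × B̂_{S′} → B × B̂) = r ≫ (ψ × 1)` as maps to `B ×_S B̂`
  have e1 : (baseChangeHom (baseChangeHom ψ g) f').left ≫ pullback.fst (B.baseChange g).X.hom f' =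
      pullback.fst (A'.baseChange g).X.hom f' ≫ (baseChangeHom ψ g).left :=
    baseChangeHom_left_comp_fst (baseChangeHom ψ g) f'
  have e1' : (baseChangeHom (baseChangeHom ψ g) f').left ≫ pullback.snd (B.baseChange g).X.hom f' =
      pullback.snd (A'.baseChange g).X.hom f' :=
    Over.w (baseChangeHom (baseChangeHom ψ g) f')
  have e2 : (baseChangeHom ψ g).left ≫ pullback.fst B.X.hom g = pullback.fst A'.X.hom g ≫ ψ.left :=
    baseChangeHom_left_comp_fst ψ g
  have e2' : (baseChangeHom ψ DB.hat.X.hom).left ≫ pullback.snd B.X.hom DB.hat.X.hom =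
      pullback.snd A'.X.hom DB.hat.X.hom :=
    Over.w (baseChangeHom ψ DB.hat.X.hom)
  have e3 : A'.bcHomLeft g f' ≫ pullback.fst (A'.baseChange g).X.hom f' ≫ pullback.fst A'.X.hom g =
      pullback.fst A'.X.hom (f' ≫ g) :=
    A'.baseChangeCompGrpIso_hom_left_fst_fst g f'
  have e3' : A'.bcHomLeft g f' ≫ pullback.snd (A'.baseChange g).X.hom f' = pullback.snd A'.X.hom (f' ≫ g) :=
    A'.baseChangeCompGrpIso_hom_left_snd g f'
  -- right-hand sides of the two projections
  have eR₁ : r ≫ (baseChangeHom ψ DB.hat.X.hom).left ≫ pullback.fst B.X.hom DB.hat.X.hom =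
      pullback.fst A'.X.hom (f' ≫ g) ≫ ψ.left :=
    (congrArg (r ≫ ·) (baseChangeHom_left_comp_fst ψ DB.hat.X.hom)).trans
      ((Category.assoc _ _ _).symm.trans (congrArg (· ≫ ψ.left) hr₁))
  have eR₂ : r ≫ (baseChangeHom ψ DB.hat.X.hom).left ≫ pullback.snd B.X.hom DB.hat.X.hom =
      pullback.snd A'.X.hom (f' ≫ g) ≫ u :=
    (congrArg (r ≫ ·) e2').trans hr₂
  -- left-hand sides of the two projections
  have step₁ : (baseChangeHom (baseChangeHom ψ g) f').left ≫ pullback.fst (B.baseChange g).X.hom f' ≫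
      pullback.fst B.X.hom g = pullback.fst (A'.baseChange g).X.hom f' ≫ pullback.fst A'.X.hom g ≫ ψ.left :=
    (Category.assoc _ _ _).symm.trans ((congrArg (· ≫ pullback.fst B.X.hom g) e1).trans
      ((Category.assoc _ _ _).trans (congrArg (pullback.fst (A'.baseChange g).X.hom f' ≫ ·) e2)))
  have eL₁ : A'.bcHomLeft g f' ≫ (baseChangeHom (baseChangeHom ψ g) f').left ≫ DB.prodBaseChangeToProd g ≫
      pullback.fst B.X.hom DB.hat.X.hom = pullback.fst A'.X.hom (f' ≫ g) ≫ ψ.left :=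
    (congrArg (fun x => A'.bcHomLeft g f' ≫ (baseChangeHom (baseChangeHom ψ g) f').left ≫ x)
      (DB.prodBaseChangeToProd_fst g)).trans
      ((congrArg (A'.bcHomLeft g f' ≫ ·) step₁).trans ((reassoc_of% e3) ψ.left))
  have step₂ : (baseChangeHom (baseChangeHom ψ g) f').left ≫ pullback.snd (B.baseChange g).X.hom f' ≫ u =
      pullback.snd (A'.baseChange g).X.hom f' ≫ u :=
    (Category.assoc _ _ _).symm.trans (congrArg (· ≫ u) e1')
  have eL₂ : A'.bcHomLeft g f' ≫ (baseChangeHom (baseChangeHom ψ g) f').left ≫ DB.prodBaseChangeToProd g ≫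
      pullback.snd B.X.hom DB.hat.X.hom = pullback.snd A'.X.hom (f' ≫ g) ≫ u :=
    (congrArg (fun x => A'.bcHomLeft g f' ≫ (baseChangeHom (baseChangeHom ψ g) f').left ≫ x)
      (DB.prodBaseChangeToProd_snd g)).trans
      ((congrArg (A'.bcHomLeft g f' ≫ ·) step₂).trans ((reassoc_of% e3') u))
  have h2 : A'.bcHomLeft g f' ≫ (baseChangeHom (baseChangeHom ψ g) f').left ≫ DB.prodBaseChangeToProd g =
      r ≫ (baseChangeHom ψ DB.hat.X.hom).left := by
    apply pullback.hom_ext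
    · simp only [Category.assoc]
      exact eL₁.trans eR₁.symm
    · simp only [Category.assoc]
      exact eL₂.trans eR₂.symm
  obtain ⟨i⟩ := nonempty_pullbackP_dualIsogeny_iso ψ D' DB
  refine ⟨?_⟩
  -- unfold both sides to pull-backs of the Poincaré modules
  change (Scheme.Modules.pullback (A'.baseChangeToProd D'.hat (f' ≫ g) (u ≫ dualIsogeny ψ D' DB) _)).obj D'.P ≅
    (Scheme.Modules.pullback (A'.bcHomLeft g f')).obj
      ((Scheme.Modules.pullback (baseChangeHom (baseChangeHom ψ g) f').left).obj
        ((Scheme.Modules.pullback (DB.prodBaseChangeToProd g)).obj DB.P))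
  exact ((Scheme.Modules.pullbackCongr h1).app D'.P).symm ≪≫
    ((Scheme.Modules.pullbackComp r _).app D'.P).symm ≪≫
    (Scheme.Modules.pullback r).mapIso i ≪≫
    (Scheme.Modules.pullbackComp r (baseChangeHom ψ DB.hat.X.hom).left).app DB.P ≪≫
    ((Scheme.Modules.pullbackCongr h2).app DB.P).symm ≪≫
    ((Scheme.Modules.pullbackComp (A'.bcHomLeft g f') _).app DB.P).symm ≪≫
    (Scheme.Modules.pullback (A'.bcHomLeft g f')).mapIso
      ((Scheme.Modules.pullbackComp (baseChangeHom (baseChangeHom ψ g) f').left (DB.prodBaseChangeToProd g)).app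
        DB.P).symm

/-- **THE DUAL HOMOMORPHISM COMMUTES WITH BASE CHANGE**: `(ψ_{S′})^∨ ≫ pr_{Â′} = pr_{B̂} ≫ ψ^∨`, where `(ψ_{S′})^∨`
is the dual of `ψ_{S′} : A′_{S′} → B_{S′}` with respect to the base-changed dual pairs `(Â′ ×_S S′, 𝒫′_{S′})`,
`(B̂ ×_S S′, 𝒫_{B,S′})`. [cite: MumfordFogartyKirwan1994, Ch. 6 §1 Cor. 6.8 (p. 118)] [cite: MumfordAV1970, §15 Thm. 1 (p. 143)] -/
theorem dualIsogeny_baseChange_comp_fst :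
    @dualIsogeny S' (A'.baseChange g) (B.baseChange g) (baseChangeHom ψ g) (isMonHom_baseChangeHom ψ g)
        (D'.baseChange g) (DB.baseChange g) ≫ pullback.fst D'.hat.X.hom g =
      pullback.fst DB.hat.X.hom g ≫ dualIsogeny ψ D' DB := by
  haveI := isMonHom_baseChangeHom ψ g
  have hL := D'.classify_baseChange_comp_fst g (DB.hatBaseChange g).X.hom
    (pullbackSelfBundle (baseChangeHom ψ g) (DB.baseChange g))
    (pullbackSelfBundle_fibrewisePicZero (baseChangeHom ψ g) (DB.baseChange g))
  have hR := D'.eq_classify ((DB.hatBaseChange g).X.hom ≫ g)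
    (pullbackSelfBundle (baseChangeHom ψ g) (DB.baseChange g)).alongBaseChange
    (RigidifiedLineBundle.alongBaseChange_fibrewisePicZero
      (pullbackSelfBundle_fibrewisePicZero (baseChangeHom ψ g) (DB.baseChange g)))
    (pullback.fst DB.hat.X.hom g ≫ dualIsogeny ψ D' DB) (fst_comp_dualIsogeny_comp_hom g ψ D' DB)
    (nonempty_pullbackP_fst_comp_dualIsogeny_iso g ψ D' DB)
  exact hL.trans hR.symm

/-- `(ψ_{S′})^∨` lies over `S′`: `(ψ_{S′})^∨ ≫ pr_{S′} = pr_{S′}`. [cite: MilneAV2008, I §8 pp. 36–37] -/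
theorem dualIsogeny_baseChange_comp_snd :
    @dualIsogeny S' (A'.baseChange g) (B.baseChange g) (baseChangeHom ψ g) (isMonHom_baseChangeHom ψ g)
        (D'.baseChange g) (DB.baseChange g) ≫ pullback.snd D'.hat.X.hom g = pullback.snd DB.hat.X.hom g :=
  @dualIsogeny_comp_hom S' (A'.baseChange g) (B.baseChange g) (baseChangeHom ψ g) (isMonHom_baseChangeHom ψ g)
    (D'.baseChange g) (DB.baseChange g)

/-- **`(ψ_{S′})^∨ = ψ^∨ ×_S S′`** as a morphism `B̂ ×_S S′ → Â′ ×_S S′` (the lift of `(pr_{B̂} ≫ ψ^∨, pr_{S′})`).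
[cite: MumfordFogartyKirwan1994, Ch. 6 §1 Cor. 6.8 (p. 118)] [cite: MumfordAV1970, §15 Thm. 1 (p. 143)] -/
theorem dualIsogeny_baseChange_eq_lift :
    @dualIsogeny S' (A'.baseChange g) (B.baseChange g) (baseChangeHom ψ g) (isMonHom_baseChangeHom ψ g)
        (D'.baseChange g) (DB.baseChange g) =
      pullback.lift (pullback.fst DB.hat.X.hom g ≫ dualIsogeny ψ D' DB) (pullback.snd DB.hat.X.hom g)
        (by rw [Category.assoc, dualIsogeny_comp_hom, pullback.condition]) := by
  apply pullback.hom_ext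
  · erw [pullback.lift_fst]; exact dualIsogeny_baseChange_comp_fst g ψ D' DB
  · erw [pullback.lift_snd]; exact dualIsogeny_baseChange_comp_snd g ψ D' DB

end DualPair

end AbelianSchemeOver

end Literature.AlgebraicGeometry.AbelianSchemes

end
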